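import Summits.Ventures.CertifiedManyBodySolver.Rows.HomTorusLocalHamiltonian
import Summits.Ventures.CertifiedManyBodySolver.Rows.HomTorusEnergyDensity
import Literature.MathematicalPhysics.QuantumLattice.HubbardNNNHoppingWindowCertificate
import HarnessLib

/-!
# Torus ceiling, tori generated by an additive lattice map — Part IV: the window certificate transported

(Parts I–III: `HomTorusModel`, `HomTorusLocalHamiltonian`, `HomTorusEnergyDensity`; uses: `TorusCeilingCRT`
(Chinese-remainder rings = rectangular PP tori `3 × 4`, `3 × 5`) and `TorusCeilingCRTRect` (the graph
isomorphisms onto `fermionRectTorusGraph 3 4 / 3 5`).)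

HONEST FRAMING: first certified bounds; not a superconductivity verdict; every number certified or
labelled float.
This file is the KERNEL TRANSPORT of a translation + EOM + charge-row window certificate (Han 2020 /
Kull–Schuch–Dive–Navascués 2024 shape, EXACTLY the hypotheses of
`Literature.MathematicalPhysics.QuantumLattice.groundEnergyAt_div_ge_of_window_certificate`, with the
SHARP admissibility "`φ` injective on the window `Λ'`") to the Hubbard model on the torus generated
by an additive lattice map `φ : ℤ^d →+ (ℤ/Nℤ)^{d'}` with non-degenerate hops
(`homTorus_minEnergyOn_div_ge_of_window_certificate`):
`c − Σ‖aₖ‖ + (Σ_σ μ_σ)(n/N^{d'} − ν) ≤ minEnergyOn (homHubbard φ t U) (szSector 2n 0) / N^{d'}` for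
every `n ≤ N^{d'}`. Mechanism: Han's translation averaging through the tree's d-general engine
`torus_minEnergyOn_div_ge_of_local_certificate` — the translates of `Γ(ι) E_Φ` over `(ℤ/N)^{d'}` sum
to `homHubbard φ t U` (Part III), translation rows become defects of `U_{φ v}`, EOM rows transport by
the sharp commutator lemma of Part II, charged words are commutators with the conserved `N̂` / `S^z`,
anti-Hermitian parts drop out of real expectations, residual words cost their norm. Not covered
(correctly): point-group rows; twisted sectors (they need a flux engine, cf. `TorusCeilingFlux`).

References: Han 2020 §3 (doi:10.1103/PhysRevLett.125.041601); Kull–Schuch–Dive–Navascués 2024 §5.3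
(doi:10.1103/PhysRevX.14.021008); Bratteli–Robinson II §5.2.2, §6.2.4 (CAR functoriality).
[cite: Han2020Bootstrap, §3] [cite: KullEtAl2024, §5.3] [cite: BratteliRobinsonII1997, §5.2.2]
-/

noncomputable section

open Matrix Finset
open Literature.MathematicalPhysics.QuantumLattice
open Literature.MathematicalPhysics.QuantumFieldTheory hiding Site
open Literature.MathematicalPhysics.QuantumManyBody.StateRelaxation
open Literature.Probability.LatticeModels
open HubbardWave0
open scoped ComplexOrder ComplexConjugate

namespace Summit.Ventures.CertifiedManyBodySolver.Rows

section Window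

variable {d d' N : ℕ} [NeZero N]

/-! ### The theorem: window certificate ⇒ the torus generated by `φ` -/

/-- **Window certificate ⇒ energy per site of the Hubbard torus generated by an additive lattice
map.** Let `φ : ℤ^d →+ (ℤ/Nℤ)^{d'}` be additive with NON-DEGENERATE HOPS (the `2d` vectors `±φ(eᵢ)`
pairwise distinct) and take EXACTLY the data of the tree's
`groundEnergyAt_div_ge_of_window_certificate` — a window identity on `𝔄_{Λ'}` for the Hubbard
interaction `hubbardFermionInteraction d t U` built from a Gram (SOS) term, EOM rows `[h_{Λ'}, Γ B]`
(`B ∈ 𝔄_Λ`, `Λ'` containing all lattice neighbours of `Λ`), translation rows `Γ(τ_v) Y − Y`,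
charged ladder words, anti-Hermitian parts and residual words — with the SHARP admissibility
"`φ` injective on `Λ'`". Then the certified constant bounds the `S^z = 0`, `2n`-particle ground-energy
density of `homHubbard φ t U` (the Hubbard model on the Cayley graph of `(ℤ/Nℤ)^{d'}` generated by the
`φ(eᵢ)`): `c − Σ‖aₖ‖ + (Σ_σ μ_σ)(n/N^{d'} − ν) ≤ minEnergyOn (homHubbard φ t U) (szSector 2n 0) / N^{d'}`.
Mechanism: Han's translation averaging on the abstract torus
(`torus_minEnergyOn_div_ge_of_local_certificate`) — the translates of `Γ(ι) E_Φ` sum to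
`homHubbard φ t U` (`sum_relabel_translate_homEmb_meanEnergyObs`, this is where non-degeneracy of the
hops enters), translation rows become the symmetry defects of `U_{φ v}`, EOM rows transport by the
sharp commutator lemma `homHubbard_commutator_fermionEmbed`, charged words are commutators with the
conserved `N̂` / `S^z`. USE (CRT): for coprime `a, b` the rectangular PP torus `ℤ/a × ℤ/b` with
nearest-neighbour hops is the ring `ℤ/(ab)` with hops `±b·(b⁻¹ mod a)·… `, e.g. `3×4 = ℤ/12` with hops
`{±4, ±9 = ∓3}` (`crtHom34` below), so square-lattice window certificates bound rectangular PP tori in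
the kernel. Not covered (correctly): point-group rows; one-seam (PA/AP) rectangular sectors.
[cite: Han2020Bootstrap, §3] [cite: KullEtAl2024, §5.3] -/
theorem homTorus_minEnergyOn_div_ge_of_window_certificate (φ : Site d →+ TorusSite d' N) (t U : ℝ)
    (hd : Function.Injective (signedHop φ)) {nh : ℕ} (hn : nh ≤ Fintype.card (FermionTorus d' N))
    {Λ Λ' : Finset (Site d)} (hΛ : Λ ⊆ Λ')
    (hclosed : ∀ x ∈ Λ, ∀ i : Fin d, x + unitVec i ∈ Λ' ∧ x - unitVec i ∈ Λ')
    (h0 : thicken ({0} : Finset (Site d)) 1 ⊆ Λ') (hz : (0 : Site d) ∈ Λ')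
    (hInj' : Set.InjOn φ ↑Λ')
    (μ : Fin 2 → ℝ) (ν : ℝ)
    {m : Type*} [Fintype m] [DecidableEq m] {Λm : Matrix m m ℂ} (hΛm : Λm.PosSemidef)
    (O : m → FermionOp Λ')
    {κ : Type*} (s : Finset κ) (B : κ → FermionOp Λ)
    {ι : Type*} (tt : Finset ι) (v : ι → Site d) (hsh : ∀ l, shiftSet (v l) Λ ⊆ Λ') (Y : ι → FermionOp Λ)
    {γ : Type*} (u : Finset γ) (b : γ → ℂ) (cw : γ → List (Orb (PolySite Λ') × Bool))
    (hcw : ∀ j ∈ u, ladderCharge (cw j) ≠ 0 ∨ ladderSpinCharge (cw j) ≠ 0)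
    {δ : Type*} (ah : Finset δ) (dc : δ → ℝ) (V : δ → FermionOp Λ')
    {κ'' : Type*} (w : Finset κ'') (a : κ'' → ℂ) (word : κ'' → List (Orb (PolySite Λ') × Bool)) {c : ℝ}
    (hcert : fermionEmbed (PolySite.incl h0) ((hubbardFermionInteraction d t U).meanEnergyObs 1) -
        (c : ℂ) • (1 : FermionOp Λ') -
        ∑ σ : Fin 2, ((μ σ : ℝ) : ℂ) • (nAt 0 hz σ - ((ν : ℝ) : ℂ) • (1 : FermionOp Λ')) =
      gramForm Λm O +
        (∑ k ∈ s, ((hubbardFermionInteraction d t U).localHamiltonian Λ' * fermionEmbed (PolySite.incl hΛ) (B k) -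
            fermionEmbed (PolySite.incl hΛ) (B k) * (hubbardFermionInteraction d t U).localHamiltonian Λ') +
          ∑ l ∈ tt, (fermionEmbed (PolySite.incl (hsh l)) (fermionEmbed (PolySite.shiftEmb (v l) Λ) (Y l)) -
            fermionEmbed (PolySite.incl hΛ) (Y l)) +
          ∑ j ∈ u, b j • ladderWord (cw j)) +
        (∑ m' ∈ ah, ((dc m' : ℝ) : ℂ) • ((V m')ᴴ - V m') + ∑ k ∈ w, a k • ladderWord (word k))) :
    c - ∑ k ∈ w, ‖a k‖ + (∑ σ : Fin 2, μ σ) * ((nh : ℝ) / (N : ℝ) ^ d' - ν) ≤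
      (homHubbard φ t U).minEnergyOn (szSector (2 * nh) 0) / (N : ℝ) ^ d' := by
  -- elaborate the torus identities below with the order-derived `DecidableEq`, as the tree's torus
  -- engine does; the statement itself does not depend on the instance.
  letI instDE : DecidableEq (FermionTorus d' N) := LinearOrder.toDecidableEq
  have hInjΛ : Set.InjOn φ ↑Λ := hInj'.mono (by exact_mod_cast hΛ)
  have hInj0 : Set.InjOn φ ↑(thicken ({0} : Finset (Site d)) 1) := hInj'.mono (by exact_mod_cast h0)
  set Γ' := fermionEmbed (homEmb φ hInj') with hΓ'
  set ΓΛ := fermionEmbed (homEmb φ hInjΛ) with hΓΛ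
  set H := homHubbard φ t U with hH
  set EΦ := (hubbardFermionInteraction d t U).meanEnergyObs 1 with hEΦ
  -- Hamiltonian data
  have hA : H.IsHermitian := homHubbard_isHermitian φ t U
  have hKA : ∀ ψ ∈ (szSector (2 * nh) 0 : Submodule ℂ (Fock (Orb (FermionTorus d' N)))),
      H *ᵥ ψ ∈ (szSector (2 * nh) 0 : Submodule ℂ (Fock (Orb (FermionTorus d' N)))) :=
    fun ψ hψ => mulVec_homHubbard_mem_szSector φ t U hψ
  have hTA : ∀ v' : TorusSite d' N, (fockTranslate v').val * H = H * (fockTranslate v').val :=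
    fun v' => fockTranslate_mul_homHubbard φ v' t U
  -- the objective: `Γ' (Γ(incl) E_Φ) = Γ(ι₀) E_Φ`, whose translates sum to `H`
  set X := Γ' (fermionEmbed (PolySite.incl h0) EΦ) with hX
  have hX0 : X = fermionEmbed (homEmb φ hInj0) EΦ := fermionEmbed_homEmb_incl φ h0 hInj' EΦ
  have hsum : ∑ v' : TorusSite d' N, (fockTranslate v').val * X * (fockTranslate v').valᴴ = H := by
    rw [hX0]
    have h := sum_relabel_translate_homEmb_meanEnergyObs φ t U hInj0 hd
    simp_rw [relabel_eq_fockRelabel_conj] at h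
    exact h
  -- density observables
  set D : Fin 2 → Matrix (Finset (Orb (FermionTorus d' N))) (Finset (Orb (FermionTorus d' N))) ℂ :=
    fun σ => numberOp (FermionTorus.ofTorusSite (0 : TorusSite d' N)) σ with hD
  set G : Fin 2 → Matrix (Finset (Orb (FermionTorus d' N))) (Finset (Orb (FermionTorus d' N))) ℂ :=
    fun σ => ∑ y : FermionTorus d' N, numberOp y σ with hG
  have hDΓ : ∀ σ, Γ' (nAt 0 hz σ) = D σ := fun σ => fermionEmbed_homEmb_nAt_zero φ hz hInj' σ
  have hDsum : ∀ σ ∈ (Finset.univ : Finset (Fin 2)),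
      ∑ v' : TorusSite d' N, (fockTranslate v').val * D σ * (fockTranslate v').valᴴ = G σ :=
    fun σ _ => sum_conj_fockTranslate_numberOp 0 σ
  have hGh : ∀ σ ∈ (Finset.univ : Finset (Fin 2)), (G σ).IsHermitian := fun σ _ => isHermitian_sum_numberOp σ
  have hGs : ∀ σ ∈ (Finset.univ : Finset (Fin 2)),
      ∀ ψ ∈ (szSector (2 * nh) 0 : Submodule ℂ (Fock (Orb (FermionTorus d' N)))),
        G σ *ᵥ ψ = (((nh : ℝ) : ℝ) : ℂ) • ψ := by
    intro σ _ ψ hψ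
    rw [hG, spinNumber_mulVec_of_mem_szSector σ hψ]
    congr 1
    push_cast
    ring
  -- symmetry (translation) family `U_{φ v}`
  set Us : ι → Matrix (Finset (Orb (FermionTorus d' N))) (Finset (Orb (FermionTorus d' N))) ℂ :=
    fun l => (fockTranslate (φ (v l))).val with hUs
  set Yt : ι → Matrix (Finset (Orb (FermionTorus d' N))) (Finset (Orb (FermionTorus d' N))) ℂ :=
    fun l => ΓΛ (Y l) with hYt
  have hU : ∀ l ∈ tt, Us l * H = H * Us l := fun l _ => hTA _
  have hUK : ∀ l ∈ tt, ∀ ψ ∈ (szSector (2 * nh) 0 : Submodule ℂ (Fock (Orb (FermionTorus d' N)))),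
      Us l *ᵥ ψ ∈ (szSector (2 * nh) 0 : Submodule ℂ (Fock (Orb (FermionTorus d' N)))) :=
    fun l _ ψ hψ => fockTranslate_mulVec_mem_szSector _ hψ
  have hUK' : ∀ l ∈ tt, ∀ ψ ∈ (szSector (2 * nh) 0 : Submodule ℂ (Fock (Orb (FermionTorus d' N)))),
      (Us l)ᴴ *ᵥ ψ ∈ (szSector (2 * nh) 0 : Submodule ℂ (Fock (Orb (FermionTorus d' N)))) :=
    fun l _ ψ hψ => fockTranslate_conjTranspose_mulVec_mem_szSector _ hψ
  have hUU : ∀ l ∈ tt, (Us l)ᴴ * Us l = 1 := fun l _ => fockTranslate_conjTranspose_mul_self _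
  -- charge family (charged words as commutators with `N̂` / `S^z`)
  set emb : Orb (PolySite Λ') × Bool → Orb (FermionTorus d' N) × Bool :=
    fun p => (Orb.embMap (homEmb φ hInj') p.1, p.2) with hemb
  set C : γ → Matrix (Finset (Orb (FermionTorus d' N))) (Finset (Orb (FermionTorus d' N))) ℂ :=
    fun j => if ladderCharge ((cw j).map emb) ≠ 0 then totalNumber else HubbardWave0.spinZ with hC
  set W : γ → Matrix (Finset (Orb (FermionTorus d' N))) (Finset (Orb (FermionTorus d' N))) ℂ :=
    fun j => (b j / (if ladderCharge ((cw j).map emb) ≠ 0 then ((ladderCharge ((cw j).map emb) : ℤ) : ℂ)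
      else ((ladderSpinCharge ((cw j).map emb) : ℤ) : ℂ) / 2)) • ladderWord ((cw j).map emb) with hW
  have hC1 : ∀ j ∈ u, C j * H = H * C j := by
    intro j _
    by_cases hq : ladderCharge ((cw j).map emb) ≠ 0
    · simp only [hC, hq, ne_eq, not_false_eq_true, if_true]
      exact (homHubbard_commute_totalNumber φ t U).symm.eq
    · simp only [hC, hq, if_false]
      exact (homHubbard_commute_spinZ φ t U).symm.eq
  have hCK : ∀ j ∈ u, ∀ ψ ∈ (szSector (2 * nh) 0 : Submodule ℂ (Fock (Orb (FermionTorus d' N)))),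
      C j *ᵥ ψ ∈ (szSector (2 * nh) 0 : Submodule ℂ (Fock (Orb (FermionTorus d' N)))) := by
    intro j _ ψ hψ
    obtain ⟨hNψ, hSψ⟩ := (mem_szSector_iff _ _ ψ).1 hψ
    by_cases hq : ladderCharge ((cw j).map emb) ≠ 0
    · simp only [hC, hq, ne_eq, not_false_eq_true, if_true]
      rw [totalNumber_mulVec_of_isNParticle hNψ]
      exact Submodule.smul_mem _ _ hψ
    · simp only [hC, hq, if_false]
      rw [hSψ]
      exact Submodule.smul_mem _ _ hψ
  have hCh : ∀ j, (C j)ᴴ = C j := by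
    intro j
    by_cases hq : ladderCharge ((cw j).map emb) ≠ 0
    · simp only [hC, hq, ne_eq, not_false_eq_true, if_true]
      rw [totalNumber_eq_numberDiag_univ]
      exact numberDiag_conjTranspose _
    · simp only [hC, hq, if_false]; exact HubbardWave0.spinZ_isHermitian.eq
  have hCK' : ∀ j ∈ u, ∀ ψ ∈ (szSector (2 * nh) 0 : Submodule ℂ (Fock (Orb (FermionTorus d' N)))),
      (C j)ᴴ *ᵥ ψ ∈ (szSector (2 * nh) 0 : Submodule ℂ (Fock (Orb (FermionTorus d' N)))) :=
    fun j hj ψ hψ => by rw [hCh j]; exact hCK j hj ψ hψ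
  have hcharged : ∀ j ∈ u, Γ' (b j • ladderWord (cw j)) = C j * W j - W j * C j := by
    intro j hj
    rw [map_smul, hΓ', fermionEmbed_ladderWord]
    have hl : ladderCharge ((cw j).map emb) ≠ 0 ∨ ladderSpinCharge ((cw j).map emb) ≠ 0 := by
      rw [hemb, ladderCharge_map_embMap, ladderSpinCharge_map_embMap]; exact hcw j hj
    exact smul_ladderWord_eq_commutator_of_charged (b j) _ hl
  -- residual words
  set M : κ'' → Matrix (Finset (Orb (FermionTorus d' N))) (Finset (Orb (FermionTorus d' N))) ℂ :=
    fun k => ladderWord ((word k).map emb) with hM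
  have hMc : ∀ k ∈ w, (M k).IsContraction := fun k _ => by
    rw [hM]; dsimp only; rw [ladderWord_eq_prod]; exact isContraction_prod_ladder _
  -- the identity, pulled back into the torus
  have htorus : X - (c : ℂ) • (1 : Matrix (Finset (Orb (FermionTorus d' N))) (Finset (Orb (FermionTorus d' N))) ℂ) -
      ∑ σ ∈ (Finset.univ : Finset (Fin 2)), ((μ σ : ℝ) : ℂ) • (D σ - ((ν : ℝ) : ℂ) •
        (1 : Matrix (Finset (Orb (FermionTorus d' N))) (Finset (Orb (FermionTorus d' N))) ℂ)) =
      gramForm Λm (fun i => Γ' (O i)) +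
        (∑ k ∈ s, (H * Γ' (fermionEmbed (PolySite.incl hΛ) (B k)) - Γ' (fermionEmbed (PolySite.incl hΛ) (B k)) * H) +
          ∑ l ∈ tt, (Us l * Yt l * (Us l)ᴴ - Yt l) +
          ∑ i ∈ (∅ : Finset (Fin 0)), ((0 : Matrix _ _ ℂ) * ((0 : Matrix _ _ ℂ) - (((0 : ℝ) : ℝ) : ℂ) • 1) +
            ((0 : Matrix _ _ ℂ) - (((0 : ℝ) : ℝ) : ℂ) • 1) * (0 : Matrix _ _ ℂ)) +
          ∑ j ∈ u, (C j * W j - W j * C j)) +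
        (∑ m' ∈ ah, ((dc m' : ℝ) : ℂ) • ((Γ' (V m'))ᴴ - Γ' (V m')) + ∑ k ∈ w, a k • M k) := by
    have key := congrArg Γ' hcert
    -- left-hand side
    rw [map_sub, map_sub, map_smul, map_one, map_sum] at key
    have hlhs : ∑ σ : Fin 2, Γ' (((μ σ : ℝ) : ℂ) • (nAt 0 hz σ - ((ν : ℝ) : ℂ) • (1 : FermionOp Λ'))) =
        ∑ σ ∈ (Finset.univ : Finset (Fin 2)), ((μ σ : ℝ) : ℂ) • (D σ - ((ν : ℝ) : ℂ) •
          (1 : Matrix (Finset (Orb (FermionTorus d' N))) (Finset (Orb (FermionTorus d' N))) ℂ)) :=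
      Finset.sum_congr rfl fun σ _ => by rw [map_smul, map_sub, map_smul, map_one, hDΓ]
    rw [hlhs] at key
    -- right-hand side, family by family
    have h1 : Γ' (∑ k ∈ s, ((hubbardFermionInteraction d t U).localHamiltonian Λ' * fermionEmbed (PolySite.incl hΛ) (B k) -
        fermionEmbed (PolySite.incl hΛ) (B k) * (hubbardFermionInteraction d t U).localHamiltonian Λ')) =
        ∑ k ∈ s, (H * Γ' (fermionEmbed (PolySite.incl hΛ) (B k)) - Γ' (fermionEmbed (PolySite.incl hΛ) (B k)) * H) := by
      rw [map_sum]
      refine Finset.sum_congr rfl fun k _ => ?_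
      rw [hH, hΓ', homHubbard_commutator_fermionEmbed φ t U hΛ hclosed hInj' (B k)]
    have h2 : Γ' (∑ l ∈ tt, (fermionEmbed (PolySite.incl (hsh l)) (fermionEmbed (PolySite.shiftEmb (v l) Λ) (Y l)) -
        fermionEmbed (PolySite.incl hΛ) (Y l))) = ∑ l ∈ tt, (Us l * Yt l * (Us l)ᴴ - Yt l) := by
      rw [map_sum]
      refine Finset.sum_congr rfl fun l _ => ?_
      rw [hUs, hYt, hΓΛ, hΓ']
      exact fermionEmbed_homEmb_shift_sub φ hΛ (v l) (hsh l) hInj' (Y l)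
    have h3 : Γ' (∑ j ∈ u, b j • ladderWord (cw j)) = ∑ j ∈ u, (C j * W j - W j * C j) := by
      rw [map_sum]
      exact Finset.sum_congr rfl hcharged
    have h4 : Γ' (∑ m' ∈ ah, ((dc m' : ℝ) : ℂ) • ((V m')ᴴ - V m')) =
        ∑ m' ∈ ah, ((dc m' : ℝ) : ℂ) • ((Γ' (V m'))ᴴ - Γ' (V m')) := by
      rw [map_sum]
      refine Finset.sum_congr rfl fun m' _ => ?_
      rw [map_smul, map_sub, hΓ', fermionEmbed_conjTranspose]
    have h5 : Γ' (∑ k ∈ w, a k • ladderWord (word k)) = ∑ k ∈ w, a k • M k := by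
      rw [map_sum]
      refine Finset.sum_congr rfl fun k _ => ?_
      rw [map_smul, hM, hΓ', fermionEmbed_ladderWord]
    rw [hX, key, map_add, map_add, map_add, map_add, map_add, hΓ', fermionEmbed_gramForm, ← hΓ', h1, h2, h3, h4, h5,
      Finset.sum_empty, add_zero]
  -- apply the torus theorem
  have hmain := torus_minEnergyOn_div_ge_of_local_certificate H hA hn hKA hTA X hsum
    (Finset.univ : Finset (Fin 2)) μ (fun _ => ν) (fun _ => (nh : ℝ)) D G hDsum hGh hGs hΛm
    (fun i => Γ' (O i)) s (fun k => Γ' (fermionEmbed (PolySite.incl hΛ) (B k))) tt Us Yt hU hUK hUK' hUU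
    (∅ : Finset (Fin 0)) (fun _ => 0) (fun _ => 0) (fun _ => 0) (fun _ => 0)
    (fun i hi => absurd hi (Finset.notMem_empty i)) (fun i hi => absurd hi (Finset.notMem_empty i))
    u C W hC1 hCK hCK' ah dc (fun m' => Γ' (V m')) w a M hMc htorus
  have hs : ∑ σ ∈ (Finset.univ : Finset (Fin 2)), μ σ * ((nh : ℝ) / (N : ℝ) ^ d' - ν) =
      (∑ σ : Fin 2, μ σ) * ((nh : ℝ) / (N : ℝ) ^ d' - ν) := by rw [Finset.sum_mul]
  rw [hs] at hmain
  exact hmain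

end Window

end Summit.Ventures.CertifiedManyBodySolver.Rows

end
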